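import Summits.QuantumAdvantage.QuantumAdvantage.Theorems.LivenessSeparationLawM
import Summits.QuantumAdvantage.QuantumAdvantage.Theorems.LivenessSeparationLawO

set_option linter.dupNamespace false

/-!
# Liveness separation, part V — the alignment step of the two-pairs end game

Lens 4 (minimal counterexample), node `CoSupportDial`, memo S-PRIME §10 (two disjoint adjacent pairs, steps (e2)–(e4)).
For an adjacent pair of cuts `g, g+1` the residues satisfy `r(g+1) ≡ r(g) + 1 + u_g` (part R), so the pair
has exactly one or exactly two live members, two iff `r(g) ≡ 1 + u_g` (`pair_liveCount`).  For two disjoint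
adjacent pairs `{a, a+1}`, `{b, b+1}` the number of live cuts among the four is therefore EVEN exactly when
the two pairs are doubly live together or not at all (`fourCuts_liveCount_even`), and then — part S — XOR-ing
any common function into the four pair registers leaves the win bit unchanged (`ringWinU_xorSet_pairs`).
On a subcube whose free coordinates all lie on one side of each of the four cuts, liveness of each cut depends
only on the number of free ones mod 3 (part P), so the evenness needs checking at three inputs only
(`fourCuts_even_of_three`): this is the ALIGNMENT CHOICE of the final frozen assignment in the memo.
-/

namespace Summit.QuantumAdvantage.QuantumAdvantage.Theorems.LivenessSeparation

open Finset Summit.QuantumAdvantage.AdviceFreeQNC0 InnerDegreeDial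

variable {n : ℕ}

/-- live indicator of a cut as a number -/
theorem liveInd_eq (c : ℕ) (u : Fin n → Bool) (g : Fin (n + 1)) :
    (if liveCut c u g = true then 1 else 0) = if (c + g.val + walkExp u g.val) % 3 ≠ 0 then 1 else 0 := by
  unfold liveCut
  by_cases h : (c + g.val + walkExp u g.val) % 3 ≠ 0
  · rw [if_pos h, if_pos (decide_eq_true h)]
  · rw [if_neg h, if_neg (by rw [decide_eq_false h]; exact Bool.false_ne_true)]

/-- **an adjacent pair has one or two live members, two iff `r ≡ 1 + u_g`** (from part R's `residue_succ_cut`) -/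
theorem pair_liveCount (c : ℕ) (u : Fin n → Bool) (g : Fin n) :
    (if liveCut c u g.castSucc = true then 1 else 0) + (if liveCut c u g.succ = true then 1 else 0)
      = if (c + g.val + walkExp u g.val + 2 * (if u g = true then 1 else 0)) % 3 = 1 then 2 else 1 := by
  rw [liveInd_eq, liveInd_eq, Fin.val_succ, Fin.val_castSucc, residue_succ_cut c u g]
  have h3 : (c + g.val + walkExp u g.val) % 3 < 3 := Nat.mod_lt _ (by omega)
  by_cases hu : u g = true
  · rw [if_pos hu]
    split_ifs <;> omega
  · rw [if_neg hu]
    split_ifs <;> omega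

/-- **two disjoint adjacent pairs carry an EVEN number of live cuts iff they are doubly live together or not at all** -/
theorem fourCuts_liveCount_even (c : ℕ) (u : Fin n → Bool) (a b : Fin n)
    (halign : (c + a.val + walkExp u a.val + 2 * (if u a = true then 1 else 0)) % 3 = 1 ↔
      (c + b.val + walkExp u b.val + 2 * (if u b = true then 1 else 0)) % 3 = 1) :
    ((if liveCut c u a.castSucc = true then 1 else 0) + (if liveCut c u a.succ = true then 1 else 0)
      + ((if liveCut c u b.castSucc = true then 1 else 0) + (if liveCut c u b.succ = true then 1 else 0))) % 2 = 0 := by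
  rw [pair_liveCount c u a, pair_liveCount c u b]
  by_cases ha : (c + a.val + walkExp u a.val + 2 * (if u a = true then 1 else 0)) % 3 = 1
  · rw [if_pos ha, if_pos (halign.1 ha)]
  · rw [if_neg ha, if_neg (fun hb => ha (halign.2 hb))]

/-- the four cuts of two disjoint adjacent pairs, as a set of cuts -/
def pairCuts (a b : Fin n) : Finset (Fin (n + 1)) := {a.castSucc, a.succ, b.castSucc, b.succ}

/-- the live count of the four cuts is the sum of the four live indicators (the pairs are disjoint: `a + 1 < b`) -/
theorem card_pairCuts_live (c : ℕ) (u : Fin n → Bool) (a b : Fin n) (hab : a.val + 1 < b.val) :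
    ((pairCuts a b).filter fun g => liveCut c u g = true).card
      = (if liveCut c u a.castSucc = true then 1 else 0) + (if liveCut c u a.succ = true then 1 else 0)
        + ((if liveCut c u b.castSucc = true then 1 else 0) + (if liveCut c u b.succ = true then 1 else 0)) := by
  have h1 : a.castSucc ≠ a.succ := fun h => by have := congrArg Fin.val h; simp [Fin.val_succ] at this
  have h2 : a.castSucc ≠ b.castSucc := fun h => by have := congrArg Fin.val h; simp at this; omega
  have h3 : a.castSucc ≠ b.succ := fun h => by have := congrArg Fin.val h; simp [Fin.val_succ] at this; omega
  have h4 : a.succ ≠ b.castSucc := fun h => by have := congrArg Fin.val h; simp [Fin.val_succ] at this; omega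
  have h5 : a.succ ≠ b.succ := fun h => by have := congrArg Fin.val h; simp [Fin.val_succ] at this; omega
  have h6 : b.castSucc ≠ b.succ := fun h => by have := congrArg Fin.val h; simp [Fin.val_succ] at this
  unfold pairCuts
  rw [card_filter, sum_insert (by simp [h1, h2, h3]), sum_insert (by simp [h4, h5]), sum_insert (by simp [h6]), sum_singleton]
  ring

/-- **THE CANCELLATION STEP OF THE TWO-PAIRS END GAME (S-PRIME §10 (e1)–(e4)):** where the two pairs are aligned, XOR-ing a common function into
the four pair registers does not change the win bit. -/
theorem ringWinU_xorSet_pairs (c : ℕ) (y : Fin (n + 1) → (Fin n → Bool) → Bool) (h : (Fin n → Bool) → Bool) (u : Fin n → Bool)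
    (a b : Fin n) (hab : a.val + 1 < b.val)
    (halign : (c + a.val + walkExp u a.val + 2 * (if u a = true then 1 else 0)) % 3 = 1 ↔
      (c + b.val + walkExp u b.val + 2 * (if u b = true then 1 else 0)) % 3 = 1) :
    ringWinU c (xorSet y (pairCuts a b) h) u = ringWinU c y u := by
  refine ringWinU_xorSet_of_even c y (pairCuts a b) h u ?_
  rw [card_pairCuts_live c u a b hab]
  exact fourCuts_liveCount_even c u a b halign

/-- same-side alignment: if the two reduced residues `r - u_g` AGREE, the pairs are aligned -/
theorem align_of_residue_eq (c : ℕ) (u : Fin n → Bool) (a b : Fin n)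
    (heq : (c + a.val + walkExp u a.val + 2 * (if u a = true then 1 else 0)) % 3
      = (c + b.val + walkExp u b.val + 2 * (if u b = true then 1 else 0)) % 3) :
    (c + a.val + walkExp u a.val + 2 * (if u a = true then 1 else 0)) % 3 = 1 ↔
      (c + b.val + walkExp u b.val + 2 * (if u b = true then 1 else 0)) % 3 = 1 := by
  rw [heq]

/-! ### on a subcube: three inputs decide -/

section Subcube

variable {m : ℕ}

/-- on a subcube whose free coordinates lie on one side of each of the four cuts, the live count of the four cuts depends only on the number of
free ones mod 3 -/
theorem card_pairCuts_live_fill (c : ℕ) (ρ : Fin n → Bool) (T : Fin m ↪ Fin n) (a b : Fin n)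
    (hside : ∀ g ∈ pairCuts a b, (∀ j, g.val ≤ (T j).val) ∨ ∀ j, (T j).val < g.val) (v v' : Fin m → Bool)
    (hvv : (univ.filter fun j => v j = true).card % 3 = (univ.filter fun j => v' j = true).card % 3) :
    ((pairCuts a b).filter fun g => liveCut c (fill ρ T v) g = true).card
      = ((pairCuts a b).filter fun g => liveCut c (fill ρ T v') g = true).card := by
  congr 1
  refine filter_congr fun g hg => ?_
  rw [liveCut_fill_oneSided c ρ T g (hside g hg) v v' hvv]

/-- **THREE INPUTS DECIDE:** on such a subcube, if the live count of the four cuts is even at three free parts with `0, 1, 2` ones mod 3, it is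
even at every point of the subcube — and XOR-ing a common function into the four pair registers preserves the win bit on the whole subcube. -/
theorem fourCuts_even_of_three (c : ℕ) (ρ : Fin n → Bool) (T : Fin m ↪ Fin n) (a b : Fin n)
    (hside : ∀ g ∈ pairCuts a b, (∀ j, g.val ≤ (T j).val) ∨ ∀ j, (T j).val < g.val) (w : Fin 3 → (Fin m → Bool))
    (hw : ∀ i : Fin 3, (univ.filter fun j => w i j = true).card % 3 = i.val)
    (heven : ∀ i : Fin 3, ((pairCuts a b).filter fun g => liveCut c (fill ρ T (w i)) g = true).card % 2 = 0)
    (v : Fin m → Bool) : ((pairCuts a b).filter fun g => liveCut c (fill ρ T v) g = true).card % 2 = 0 := by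
  have h3 : (univ.filter fun j => v j = true).card % 3 < 3 := Nat.mod_lt _ (by omega)
  set i : Fin 3 := ⟨(univ.filter fun j => v j = true).card % 3, h3⟩ with hi
  rw [card_pairCuts_live_fill c ρ T a b hside v (w i) (by rw [hw i])]
  exact heven i

/-- the end game on the subcube: with the three-inputs check, the XOR-ed strategy has the same win bit at every point of the subcube -/
theorem ringWinU_xorSet_pairs_fill (c : ℕ) (y : Fin (n + 1) → (Fin n → Bool) → Bool) (h : (Fin n → Bool) → Bool)
    (ρ : Fin n → Bool) (T : Fin m ↪ Fin n) (a b : Fin n)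
    (hside : ∀ g ∈ pairCuts a b, (∀ j, g.val ≤ (T j).val) ∨ ∀ j, (T j).val < g.val) (w : Fin 3 → (Fin m → Bool))
    (hw : ∀ i : Fin 3, (univ.filter fun j => w i j = true).card % 3 = i.val)
    (heven : ∀ i : Fin 3, ((pairCuts a b).filter fun g => liveCut c (fill ρ T (w i)) g = true).card % 2 = 0)
    (v : Fin m → Bool) : ringWinU c (xorSet y (pairCuts a b) h) (fill ρ T v) = ringWinU c y (fill ρ T v) :=
  ringWinU_xorSet_of_even c y (pairCuts a b) h (fill ρ T v) (fourCuts_even_of_three c ρ T a b hside w hw heven v)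

end Subcube

end Summit.QuantumAdvantage.QuantumAdvantage.Theorems.LivenessSeparation
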